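import Summits.HubbardSuperconductivity.HubbardSuperconductivity.Theses.TorusCooperLog
import Summits.HubbardSuperconductivity.HubbardSuperconductivity.Theorems.ChiralWindowCwThesisChannelInfNonpos
import Summits.HubbardSuperconductivity.HubbardSuperconductivity.Theorems.ChiralWindowCwThesisHalfFilling
import HarnessLib

/-!
# Route `ChiralWindow`, crux `CwThesis` (stmt-HubbardSuperconductivity-10438), line `SketchIdeator3`:
# `TorusCooperLog.KLCanonical` is equivalent to its leading-only form

Write `ε = squareDispersion 1 0`, `μ_δ = chemicalPotentialOfDensity ε (1-δ)` and
`Λ_U(δ,χ) = channelInf ε μ_δ U χ` (the bottom of the Kohn–Luttinger form `U + U² χ₀(k+k')` in the `D₄` channel `χ`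
on the Fermi curve at hole doping `δ`). The sibling crux `TorusCooperLog.KLCanonical` (stmt-HubbardSuperconductivity-2681)
asks, at each doping `δ ∈ (0,1/2)`, for a Kohn–Luttinger datum "`B₁g` ATTRACTIVE, `Λ_U(δ,B1g) ≤ -γU²`, AND LEADING
every other channel by `γU²`" before concluding the intensive pair-penalty response of the sector ground energies.

* `stub_channelInfNonposOfDoping` — `Λ_U(δ,χ) ≤ 0` for every hole doping `δ ∈ (0,1)`, every `U`, every channel `χ`:
  `Theorems.CwThesis.stub_channelInfNonpos` (every channel bottom is `≤ 0` on the band `μ ∈ (-4,0)`) at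
  `μ_δ ∈ (-4,0)` (`Theorems.CwThesis.chemicalPotentialOfDensity_doping_mem_Ioo`).
* `stub_klCanonicalIffLeading` — hence the attractivity clause of `KLCanonical` is redundant: leading by `γU²` and
  `Λ_U(δ,A2g) ≤ 0` force `Λ_U(δ,B1g) ≤ -γU²`, so `KLCanonical` is equivalent to its LEADING-ONLY variant
  (bookkeeping used to pool the cruxes stmt-10438 / stmt-2681 / stmt-2682).

No definitions. References: W. Kohn, J. M. Luttinger, Phys. Rev. Lett. 15 (1965) 524; S. Raghu, S. A. Kivelson,
D. J. Scalapino, Phys. Rev. B 81 (2010) 224505 §II–III.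
-/

noncomputable section

-- the tree's namespace repeats the summit name by design (D-0017)
set_option linter.dupNamespace false

namespace Summit.HubbardSuperconductivity.HubbardSuperconductivity.Theorems.CwThesis

open MeasureTheory Real Set Filter
open scoped Matrix
open Literature.MathematicalPhysics.QuantumLattice
open Summit.HubbardSuperconductivity.HubbardSuperconductivity.Theses

/-- **Every channel bottom is non-positive at every hole doping.** For `ε = squareDispersion 1 0`, every
`δ ∈ (0,1)`, every coupling `U` and every `D₄` channel `χ`:
`channelInf ε (chemicalPotentialOfDensity ε (1-δ)) U χ ≤ 0` — the band-level statement `stub_channelInfNonpos`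
at `μ_δ ∈ (-4,0)` (`chemicalPotentialOfDensity_doping_mem_Ioo`). [folklore] -/
theorem stub_channelInfNonposOfDoping : ∀ {δ : ℝ}, δ ∈ Set.Ioo (0 : ℝ) 1 → ∀ (U : ℝ) (χ : D4Irrep),
    channelInf (squareDispersion 1 0) (chemicalPotentialOfDensity (squareDispersion 1 0) (1 - δ)) U χ ≤ 0 :=
  fun hδ U χ => stub_channelInfNonpos U χ (chemicalPotentialOfDensity_doping_mem_Ioo hδ)

/-- **`KLCanonical` is equivalent to its leading-only form.** The hypothesis of `TorusCooperLog.KLCanonical` at a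
doping `δ ∈ (0,1/2)` asks for `B₁g` attractive (`Λ_U(δ,B1g) ≤ -γU²`) AND leading every other channel by `γU²` for all
small `U`; attractivity is automatic from leading, because every channel bottom is `≤ 0` at every hole doping
(`stub_channelInfNonposOfDoping`, applied to `χ = A2g`): `Λ_U(δ,B1g) + γU² ≤ Λ_U(δ,A2g) ≤ 0`. So replacing the
hypothesis by its leading-only part does not change the statement. [folklore] -/
theorem stub_klCanonicalIffLeading :
    TorusCooperLog.KLCanonical ↔
    ∀ δ ∈ Set.Ioo (0:ℝ) (1 / 2), (∃ γ U₁ : ℝ, 0 < γ ∧ 0 < U₁ ∧ ∀ U ∈ Set.Ioo (0:ℝ) U₁,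
      ∀ χ : D4Irrep, χ ≠ D4Irrep.B1g →
        channelInf (squareDispersion 1 0) (chemicalPotentialOfDensity (squareDispersion 1 0) (1 - δ)) U D4Irrep.B1g +
            γ * U ^ 2 ≤
          channelInf (squareDispersion 1 0) (chemicalPotentialOfDensity (squareDispersion 1 0) (1 - δ)) U χ) →
      ∃ U₀ : ℝ, 0 < U₀ ∧ ∀ U ∈ Set.Ioo (0:ℝ) U₀, ∃ κ : ℝ, 0 < κ ∧ ∃ c : ℝ, 0 < c ∧ ∀ᶠ k : ℕ in Filter.atTop,
        c * κ ≤ Matrix.minEnergyOn (hubbardTorus 2 (2 * (k + 1)) 1 U +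
            ((κ / ((2 * (k + 1) : ℕ) : ℝ) ^ 4 : ℝ) : ℂ) •
              ((pairField dWaveFormFactor (2 * (k + 1)))ᴴ * pairField dWaveFormFactor (2 * (k + 1))))
            (szSector (2 * ⌊(1 - δ) * ((2 * (k + 1) : ℕ) : ℝ) ^ 2 / 2⌋₊) 0) -
          Matrix.minEnergyOn (hubbardTorus 2 (2 * (k + 1)) 1 U)
            (szSector (2 * ⌊(1 - δ) * ((2 * (k + 1) : ℕ) : ℝ) ^ 2 / 2⌋₊) 0) := by
  refine ⟨fun hKL δ hδ hlead => ?_, fun h δ hδ hdatum => ?_⟩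
  · -- (→): rebuild the attractivity clause from leading and `Λ_U(δ,A2g) ≤ 0`
    obtain ⟨γ, U₁, hγ, hU₁, hl⟩ := hlead
    refine hKL δ hδ ⟨γ, U₁, hγ, hU₁, fun U hU => ⟨?_, hl U hU⟩⟩
    have hA : channelInf (squareDispersion 1 0) (chemicalPotentialOfDensity (squareDispersion 1 0) (1 - δ)) U
        D4Irrep.A2g ≤ 0 :=
      stub_channelInfNonposOfDoping (δ := δ) ⟨hδ.1, by linarith [hδ.2]⟩ U D4Irrep.A2g
    have hle := hl U hU D4Irrep.A2g (by decide)
    linarith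
  · -- (←): forget the attractivity clause
    obtain ⟨γ, U₁, hγ, hU₁, hd⟩ := hdatum
    exact h δ hδ ⟨γ, U₁, hγ, hU₁, fun U hU => (hd U hU).2⟩

end Summit.HubbardSuperconductivity.HubbardSuperconductivity.Theorems.CwThesis

end
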